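import Literature.Analysis.FluidPDE.PoissonGradientSupBound
import HarnessLib

/-!
# LINE g7-δ «member selection», T1 GUARD: G0 `StrainSplitBound` and G1 `EfficientCellHasStrongVorticity` PROVED

Crux `NearExtremalTransiencePerFlow` (stmt-NavierStokesRegularity-26567), line δ `member_selection`
(workfile `Cruxes/NearExtremalTransiencePerFlow/Lines/member_selection_guard.lean`, critic of record
idea-crit-4, 2026-08-28T20:03:54Z: G0 «TRUE at M–L size»). The guard's analytic input G0 — the strain
quadratic form of a bounded `C³` divergence-free field at `x` is at most
`C · (sup|v| / s + sup_{B(x,s)} |ω| + s · sup_{B(x,s)} |∇ω|) · ‖ξ‖²` for EVERY `s > 0` — is proved here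
(statement = the workfile's `def StrainSplitBound` unfolded, verbatim), from the tree's pointwise interior
gradient bound for divergence-free fields
`Literature.Analysis.FluidPDE.exists_opNorm_fderiv_le_of_isDivFree` (`‖Dv(x)‖ ≤ C (M/s + s·sup_{B(x,s)}‖D curl v‖)`,
Gilbarg–Trudinger (3.16) via the fixed-scale Green representation and `Δv = -curl curl v`): in fact the
`sup_{B(x,s)}|ω|` term is not needed (`A ≥ 0` is only used to weaken the bound). G1 follows by the
workfile's algebra of integrals (`efficientCellHasStrongVorticity_of_strainSplitBound`, reproduced).

What this buys for T1 `stub_coherentSelection`: a `κ`-efficient cell at GLOBAL height with Taylor scale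
`≤ L₁` must carry vorticity data `≳ κ² Mv / (C² L₁ (1 + L₁/κ))` on its `s`-neighbourhood — PASSIVE
super-efficient far cells (census kit j316185) are excluded by statement. Nothing here is a statement about
Navier–Stokes regularity; the crux 26567, T1, T3 and NS regularity remain OPEN. No summit is proved by a line.
-/

noncomputable section

open scoped InnerProductSpace RealInnerProductSpace
open MeasureTheory Set Metric
open Literature.Analysis.FluidPDE

namespace Summit.NavierStokesRegularity.NavierStokesRegularity.Theorems.NearExtremalTransiencePerFlow.MemberSelection.Guard

set_option linter.dupNamespace false

/-- **G0 — POINTWISE STRAIN SPLIT, proved** (the δ guard's `StrainSplitBound`, unfolded verbatim): there is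
an absolute `C > 0` such that for every bounded `C³` divergence-free `v : ℝ³ → ℝ³` (`‖v‖ ≤ Mv`), every `x`,
every `s > 0` and all `A, B` bounding `‖curl v‖`, `‖D(curl v)‖` on `B(x, s)`,
`|⟪ξ, Dv(x) ξ⟫| ≤ C (Mv / s + A + s B) ‖ξ‖²` for all `ξ`. Proof: `‖Dv(x)‖ ≤ C (Mv/s + sB)`
(`exists_opNorm_fderiv_le_of_isDivFree`), Cauchy–Schwarz, and `A ≥ ‖curl v(x)‖ ≥ 0`. -/
theorem strainSplitBound :
    ∃ C : ℝ, 0 < C ∧ ∀ (v : EuclideanSpace ℝ (Fin 3) → EuclideanSpace ℝ (Fin 3)) (Mv : ℝ),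
      ContDiff ℝ 3 v → Literature.Analysis.FluidPDE.VectorCalculus.IsDivFree v → (∀ x, ‖v x‖ ≤ Mv) →
      ∀ (x : EuclideanSpace ℝ (Fin 3)) (s A B : ℝ), 0 < s →
        (∀ y ∈ Metric.ball x s, ‖curl v y‖ ≤ A) → (∀ y ∈ Metric.ball x s, ‖fderiv ℝ (curl v) y‖ ≤ B) →
        ∀ ξ : EuclideanSpace ℝ (Fin 3), |⟪ξ, fderiv ℝ v x ξ⟫_ℝ| ≤ C * (Mv / s + A + s * B) * ‖ξ‖ ^ 2 := by
  obtain ⟨C, hC, hDv⟩ := exists_opNorm_fderiv_le_of_isDivFree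
  refine ⟨C, hC, ?_⟩
  intro v Mv hv hdiv hM x s A B hs hA hB ξ
  have hD : ‖fderiv ℝ v x‖ ≤ C * (Mv / s + s * B) :=
    hDv v x s Mv B hv hdiv hs (fun y _ => hM y) hB
  have hA0 : 0 ≤ A := (norm_nonneg _).trans (hA x (mem_ball_self hs))
  have hK : C * (Mv / s + s * B) ≤ C * (Mv / s + A + s * B) :=
    mul_le_mul_of_nonneg_left (by linarith) hC.le
  calc |⟪ξ, fderiv ℝ v x ξ⟫_ℝ| ≤ ‖ξ‖ * ‖fderiv ℝ v x ξ‖ := abs_real_inner_le_norm _ _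
    _ ≤ ‖ξ‖ * (‖fderiv ℝ v x‖ * ‖ξ‖) :=
        mul_le_mul_of_nonneg_left (ContinuousLinearMap.le_opNorm _ _) (norm_nonneg _)
    _ = ‖fderiv ℝ v x‖ * ‖ξ‖ ^ 2 := by ring
    _ ≤ C * (Mv / s + A + s * B) * ‖ξ‖ ^ 2 :=
        mul_le_mul_of_nonneg_right (hD.trans hK) (sq_nonneg _)

/-- **G1 — AN EFFICIENT CELL CONTAINS STRONG VORTICITY, proved** (the δ guard's
`EfficientCellHasStrongVorticity`, unfolded verbatim): if a measurable cell `Q` is `κ`-efficient at the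
GLOBAL height `Mv` (`κ · Mv · √Z_Q · √P_Q ≤ |J_Q|`), has Taylor scale `≤ L₁` (`Z_Q ≤ L₁² P_Q`) and non-zero
budgets, then for every `s > 0` the bounds `A ≥ |ω|`, `B ≥ |∇ω|` on the `s`-neighbourhood of `Q` satisfy
`κ · Mv ≤ C · L₁ · (Mv / s + A + s B)`. Pure algebra of integrals over G0 (the workfile's
`efficientCellHasStrongVorticity_of_strainSplitBound`). -/
theorem efficientCellHasStrongVorticity :
    ∃ C : ℝ, 0 < C ∧ ∀ (v : EuclideanSpace ℝ (Fin 3) → EuclideanSpace ℝ (Fin 3)) (Mv : ℝ),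
      ContDiff ℝ 3 v → Literature.Analysis.FluidPDE.VectorCalculus.IsDivFree v → (∀ x, ‖v x‖ ≤ Mv) →
      ∀ (Q : Set (EuclideanSpace ℝ (Fin 3))) (κ L₁ s A B : ℝ), MeasurableSet Q → 0 < L₁ → 0 < s →
        (∀ x ∈ Q, ∀ y ∈ Metric.ball x s, ‖curl v y‖ ≤ A) →
        (∀ x ∈ Q, ∀ y ∈ Metric.ball x s, ‖fderiv ℝ (curl v) y‖ ≤ B) →
        IntegrableOn (fun x => ‖curl v x‖ ^ 2) Q →
        IntegrableOn (fun x => ⟪curl v x, fderiv ℝ v x (curl v x)⟫_ℝ) Q →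
        0 < ∫ x in Q, ‖curl v x‖ ^ 2 → 0 < ∫ x in Q, frobeniusNormSq (fderiv ℝ (curl v) x) →
        (∫ x in Q, ‖curl v x‖ ^ 2) ≤ L₁ ^ 2 * ∫ x in Q, frobeniusNormSq (fderiv ℝ (curl v) x) →
        κ * Mv * Real.sqrt (∫ x in Q, ‖curl v x‖ ^ 2) * Real.sqrt (∫ x in Q, frobeniusNormSq (fderiv ℝ (curl v) x)) ≤
          |∫ x in Q, ⟪curl v x, fderiv ℝ v x (curl v x)⟫_ℝ| →
        κ * Mv ≤ C * L₁ * (Mv / s + A + s * B) := by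
  -- adapted verbatim from the workfile `member_selection_guard.lean`
  obtain ⟨C, hC, hSS⟩ := strainSplitBound
  refine ⟨C, hC, ?_⟩
  intro v Mv hv hdiv hM Q κ L₁ s A B hQ hL hs hA hB hZi hJi hZpos hPpos hTaylor heff
  set Z : ℝ := ∫ x in Q, ‖curl v x‖ ^ 2 with hZdef
  set P : ℝ := ∫ x in Q, frobeniusNormSq (fderiv ℝ (curl v) x) with hPdef
  set K : ℝ := C * (Mv / s + A + s * B) with hKdef
  -- pointwise strain bound on the cell
  have hpt : ∀ x ∈ Q, |⟪curl v x, fderiv ℝ v x (curl v x)⟫_ℝ| ≤ K * ‖curl v x‖ ^ 2 := by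
    intro x hx
    exact hSS v Mv hv hdiv hM x s A B hs (hA x hx) (hB x hx) (curl v x)
  -- integrate
  have hJ : |∫ x in Q, ⟪curl v x, fderiv ℝ v x (curl v x)⟫_ℝ| ≤ K * Z := by
    calc |∫ x in Q, ⟪curl v x, fderiv ℝ v x (curl v x)⟫_ℝ|
        ≤ ∫ x in Q, |⟪curl v x, fderiv ℝ v x (curl v x)⟫_ℝ| := abs_integral_le_integral_abs
      _ ≤ ∫ x in Q, K * ‖curl v x‖ ^ 2 := by
          exact setIntegral_mono_on hJi.abs (hZi.const_mul K) hQ hpt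
      _ = K * Z := by rw [hZdef]; exact integral_const_mul K _
  -- `K ≥ 0` (forced by `0 ≤ |J| ≤ K Z` with `Z > 0`)
  have hK : 0 ≤ K := by
    by_contra hneg
    push Not at hneg
    have : K * Z < 0 := mul_neg_of_neg_of_pos hneg hZpos
    linarith [abs_nonneg (∫ x in Q, ⟪curl v x, fderiv ℝ v x (curl v x)⟫_ℝ)]
  -- Taylor scale: `Z ≤ L₁ √Z √P`
  have hsqZ : 0 < Real.sqrt Z := Real.sqrt_pos.mpr hZpos
  have hsqP : 0 < Real.sqrt P := Real.sqrt_pos.mpr hPpos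
  have hZle : Z ≤ L₁ * Real.sqrt Z * Real.sqrt P := by
    have h1 : Real.sqrt Z ≤ L₁ * Real.sqrt P := by
      calc Real.sqrt Z ≤ Real.sqrt (L₁ ^ 2 * P) := Real.sqrt_le_sqrt hTaylor
        _ = L₁ * Real.sqrt P := by
            rw [Real.sqrt_mul (sq_nonneg L₁), Real.sqrt_sq hL.le]
    calc Z = Real.sqrt Z * Real.sqrt Z := (Real.mul_self_sqrt hZpos.le).symm
      _ ≤ (L₁ * Real.sqrt P) * Real.sqrt Z := by
          exact mul_le_mul_of_nonneg_right h1 hsqZ.le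
      _ = L₁ * Real.sqrt Z * Real.sqrt P := by ring
  -- chain and cancel `√Z √P > 0`
  have hprod : 0 < Real.sqrt Z * Real.sqrt P := mul_pos hsqZ hsqP
  have key : κ * Mv * (Real.sqrt Z * Real.sqrt P) ≤ C * L₁ * (Mv / s + A + s * B) * (Real.sqrt Z * Real.sqrt P) := by
    have h2 : K * Z ≤ K * (L₁ * Real.sqrt Z * Real.sqrt P) := mul_le_mul_of_nonneg_left hZle hK
    calc κ * Mv * (Real.sqrt Z * Real.sqrt P) = κ * Mv * Real.sqrt Z * Real.sqrt P := by ring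
      _ ≤ |∫ x in Q, ⟪curl v x, fderiv ℝ v x (curl v x)⟫_ℝ| := heff
      _ ≤ K * Z := hJ
      _ ≤ K * (L₁ * Real.sqrt Z * Real.sqrt P) := h2
      _ = C * L₁ * (Mv / s + A + s * B) * (Real.sqrt Z * Real.sqrt P) := by rw [hKdef]; ring
  exact le_of_mul_le_mul_right key hprod

end Summit.NavierStokesRegularity.NavierStokesRegularity.Theorems.NearExtremalTransiencePerFlow.MemberSelection.Guard
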